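import Summits.ABC.ABC.Theorems.TwistAmplificationMazurKaneLawRecordFineDictionary
import Summits.ABC.ABC.Theorems.TwistAmplificationMazurKaneLawRecordFineEndgame
import Summits.ABC.ABC.Theorems.TwistAmplificationMazurKaneLawRecordLPRG
import Summits.ABC.ABC.Theorems.TwistAmplificationMazurKaneLawRecordLPRH
import Summits.ABC.ABC.Theorems.TwistAmplificationMazurKaneLawRecordTransfer
import Summits.ABC.ABC.Theorems.TwistAmplificationMazurKaneLawRecordsV3

/-!
# Certified record exponents, pipeline v2 — records `RG`, `RH` (crux `TwistAmplification.MazurKaneLaw`, stmt-ABC-2757)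

Line `fibre-toolkit-lp-wall-map`, lead c3 (third independent implementation of the kit's exact linear programme and of the
certificate generator, `lp/` of the proving session; it reproduces lead c2's values `V(16/9) = 1`, `V(7/4) = 44/45`,
`V₇(1) = 67/115` and gives `V₅(1) = 24/41`). The exact value `V₅(s)` of the enlarged fibre toolkit was computed on the grid
`s = 1.00 (0.01) 1.78`; on `[57/50, 39/25]` the certified curve is now within `0.008` of it:

* `recordAt_RG` : for every `s₀ ∈ [57/50, 3/2]`, `RecordAt s₀ (17 s₀/30 + 1/50)` (kit values `.660 / .692 / .752 / .806 / .866` at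
  `1.14 / 1.2 / 1.3 / 1.4 / 1.5`; certified `.666 / .700 / .757 / .813 / .870`), below lead c2's `recordAt_RA` (`(23 s₀ + 1)/40`) by
  `(s₀ + 0.6)/120 ∈ [0.0145, 0.0175]` on this range; generated LP lemma `lp_RG` (`J = 5`, 924-cell cover tree in eight files).
* `recordAt_RH` : for every `s₀ ∈ [3/2, 39/25]`, `RecordAt s₀ (29 s₀/60 + 143/1000)` (kit `.866 / .875 / .885 / .895` at
  `1.5 / 1.52 / 1.54 / 1.56`; certified `.868 / .878 / .887 / .897`), below lead c2's `recordAt_RB` (`(19 s₀ + 7)/40`) by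
  `0.032 − s₀/120 ∈ [0.019, 0.0195]`; generated LP lemma `lp_RH` (`J = 5`, four files).

In the crux's literal shape (`mazurKane_count_le_rpow_RG/RH`): for `57/50 ≤ s < 3/2`, `#{abc triples, c ≤ N, rad(abc) ≤ c^s} ≤
C N^{17s/30 + 1/50 + ε}`; for `3/2 ≤ s < 39/25`, `≤ C N^{29s/60 + 143/1000 + ε}`. The residue of the crux is unchanged (exact value `1`
on `[16/9, 2]`, `kit_lp_value_one_at_sixteen_ninths`).
-/

noncomputable section

-- `Summit.<Summit>.<Problem>`: the duplicate `ABC.ABC` is deliberate (single-conjunct summit).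
set_option linter.dupNamespace false

namespace Summit.ABC.ABC.Theorems.MazurKaneLaw

open Summit.ABC.ABC.Theorems.MazurKaneLaw.Toolkit

/-! ### `RG`: `s₀ ∈ [57/50, 3/2]`, exponent `17 s₀/30 + 1/50` -/

/-- **Parametric fine record instance `RG`**: for every `s₀ ∈ [57/50, 3/2]`, `RecordInstanceK 3 5 s₀ (17 s₀/30 + 1/50)`, from the
generated parametric LP lemma `lp_RG`. -/
theorem recordInstance_RG : ∀ s₀ : ℝ, 57 / 50 ≤ s₀ → s₀ ≤ 3 / 2 →
    Summit.ABC.ABC.Theorems.MazurKaneLaw.Toolkit.RecordInstanceK 3 5 s₀ ((17 / 30 : ℝ) * s₀ + (1 / 50 : ℝ)) :=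
  fun s₀ h1 h2 => recordInstanceK_of_lp 3 5 s₀ ((17 / 30 : ℝ) * s₀ + (1 / 50 : ℝ)) (by norm_num) (lp_RG s₀ h1 h2)

/-- **Parametric certified record `RG`** (registered sub-goal `recordAt_RG` of crux stmt-ABC-2757): for every `s₀ ∈ [57/50, 3/2]`,
every `s < s₀` and `ε > 0`, `#{abc triples, c ≤ N, rad(abc) ≤ c^s} ≤ C · N^{17 s₀/30 + 1/50 + ε}` for `N ≥ 2`. -/
theorem recordAt_RG : ∀ s₀ : ℝ, 57 / 50 ≤ s₀ → s₀ ≤ 3 / 2 → Summit.ABC.ABC.Theorems.MazurKaneLaw.Toolkit.RecordAt s₀ ((17 / 30 : ℝ) * s₀ + (1 / 50 : ℝ)) :=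
  fun s₀ h1 h2 => recordAt_of_shapeBound 5 s₀ ((17 / 30 : ℝ) * s₀ + (1 / 50 : ℝ)) (by norm_num) (by norm_num) (by linarith)
    (by linarith) (shapeCount_le_of_recordInstanceK 3 5 s₀ ((17 / 30 : ℝ) * s₀ + (1 / 50 : ℝ)) (by norm_num) (by norm_num)
      (by linarith) (recordInstance_RG s₀ h1 h2))

/-- **`RG` in the crux's literal shape**: for `57/50 ≤ s < 3/2` and `ε > 0` there is `C` with
`#{abc triples (a,b,c) : c ≤ N, rad(abc) ≤ c^s} ≤ C · N^{17s/30 + 1/50 + ε}` for all `N ≥ 2`. Take `s₀ = min (3/2) (s + ε)` in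
`recordAt_RG` with `ε′ = ε/3`. -/
theorem mazurKane_count_le_rpow_RG (s : ℝ) (hs1 : 57 / 50 ≤ s) (hs2 : s < 3 / 2) (ε : ℝ) (hε : 0 < ε) :
    ∃ C : ℝ, ∀ N : ℕ, 2 ≤ N →
      (Set.ncard {t : ℕ × ℕ × ℕ | Literature.NumberTheory.DiophantineGeometry.IsABCTriple t.1 t.2.1 t.2.2 ∧ t.2.2 ≤ N ∧
        ((Literature.NumberTheory.DiophantineGeometry.rad t.1 t.2.1 t.2.2 : ℕ) : ℝ) ≤ (t.2.2 : ℝ) ^ s} : ℝ) ≤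
        C * (N : ℝ) ^ (17 * s / 30 + 1 / 50 + ε) := by
  -- adapted from `mazurKane_count_le_rpow_RF` (TwistAmplificationMazurKaneLawRecordsV4.lean)
  have hm1 : min (3 / 2) (s + ε) ≤ 3 / 2 := min_le_left _ _
  have hm2 : min (3 / 2) (s + ε) ≤ s + ε := min_le_right _ _
  have hm3 : s < min (3 / 2) (s + ε) := lt_min hs2 (by linarith)
  obtain ⟨C, hC⟩ := recordAt_RG (min (3 / 2) (s + ε)) (by linarith) hm1 s hm3 (ε / 3) (by positivity)
  exact ⟨max C 0, fun N hN => record_bound_mono hN (by linarith) (hC N hN)⟩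

/-! ### `RH`: `s₀ ∈ [3/2, 39/25]`, exponent `29 s₀/60 + 143/1000` -/

/-- **Parametric fine record instance `RH`**: for every `s₀ ∈ [3/2, 39/25]`, `RecordInstanceK 3 5 s₀ (29 s₀/60 + 143/1000)`, from the
generated parametric LP lemma `lp_RH`. -/
theorem recordInstance_RH : ∀ s₀ : ℝ, 3 / 2 ≤ s₀ → s₀ ≤ 39 / 25 →
    Summit.ABC.ABC.Theorems.MazurKaneLaw.Toolkit.RecordInstanceK 3 5 s₀ ((29 / 60 : ℝ) * s₀ + (143 / 1000 : ℝ)) :=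
  fun s₀ h1 h2 => recordInstanceK_of_lp 3 5 s₀ ((29 / 60 : ℝ) * s₀ + (143 / 1000 : ℝ)) (by norm_num) (lp_RH s₀ h1 h2)

/-- **Parametric certified record `RH`** (registered sub-goal `recordAt_RH` of crux stmt-ABC-2757): for every `s₀ ∈ [3/2, 39/25]`,
every `s < s₀` and `ε > 0`, `#{abc triples, c ≤ N, rad(abc) ≤ c^s} ≤ C · N^{29 s₀/60 + 143/1000 + ε}` for `N ≥ 2`. -/
theorem recordAt_RH : ∀ s₀ : ℝ, 3 / 2 ≤ s₀ → s₀ ≤ 39 / 25 → Summit.ABC.ABC.Theorems.MazurKaneLaw.Toolkit.RecordAt s₀ ((29 / 60 : ℝ) * s₀ + (143 / 1000 : ℝ)) :=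
  fun s₀ h1 h2 => recordAt_of_shapeBound 5 s₀ ((29 / 60 : ℝ) * s₀ + (143 / 1000 : ℝ)) (by norm_num) (by norm_num) (by linarith)
    (by linarith) (shapeCount_le_of_recordInstanceK 3 5 s₀ ((29 / 60 : ℝ) * s₀ + (143 / 1000 : ℝ)) (by norm_num) (by norm_num)
      (by linarith) (recordInstance_RH s₀ h1 h2))

/-- **`RH` in the crux's literal shape**: for `3/2 ≤ s < 39/25` and `ε > 0` there is `C` with
`#{abc triples (a,b,c) : c ≤ N, rad(abc) ≤ c^s} ≤ C · N^{29s/60 + 143/1000 + ε}` for all `N ≥ 2`. -/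
theorem mazurKane_count_le_rpow_RH (s : ℝ) (hs1 : 3 / 2 ≤ s) (hs2 : s < 39 / 25) (ε : ℝ) (hε : 0 < ε) :
    ∃ C : ℝ, ∀ N : ℕ, 2 ≤ N →
      (Set.ncard {t : ℕ × ℕ × ℕ | Literature.NumberTheory.DiophantineGeometry.IsABCTriple t.1 t.2.1 t.2.2 ∧ t.2.2 ≤ N ∧
        ((Literature.NumberTheory.DiophantineGeometry.rad t.1 t.2.1 t.2.2 : ℕ) : ℝ) ≤ (t.2.2 : ℝ) ^ s} : ℝ) ≤
        C * (N : ℝ) ^ (29 * s / 60 + 143 / 1000 + ε) := by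
  -- adapted from `mazurKane_count_le_rpow_RF` (TwistAmplificationMazurKaneLawRecordsV4.lean)
  have hm1 : min (39 / 25) (s + ε) ≤ 39 / 25 := min_le_left _ _
  have hm2 : min (39 / 25) (s + ε) ≤ s + ε := min_le_right _ _
  have hm3 : s < min (39 / 25) (s + ε) := lt_min hs2 (by linarith)
  obtain ⟨C, hC⟩ := recordAt_RH (min (39 / 25) (s + ε)) (by linarith) hm1 s hm3 (ε / 3) (by positivity)
  exact ⟨max C 0, fun N hN => record_bound_mono hN (by linarith) (hC N hN)⟩

end Summit.ABC.ABC.Theorems.MazurKaneLaw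

end
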